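import Mathlib
import Literature.Analysis.FluidPDE.TypeIICoreWitness
import Summits.NavierStokesRegularity.NavierStokesRegularity.Theorems.TypeIIInviscidRelaxationCoreExclusionAnchorReduction
import Summits.NavierStokesRegularity.NavierStokesRegularity.Theorems.TypeIIInviscidRelaxationColumnarCoreExclusionStubColumnarComparisonFlow
import HarnessLib

/-!
# Crux `ColumnarCoreExclusion` (stmt-1966): the anchor stub `stub_anchoredLateColumnarWitness` REDUCED to
# late columnar witnesses with a core-radius floor

`--supports stmt-NavierStokesRegularity-1966` (helper file; theorems only, no definitions, no `sorry`).  The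
class-generic reduction `CoreExclusionAnchor.anchoredLateWitness_of_lateWitnesses_radiusFloor`
(`TypeIIInviscidRelaxationCoreExclusionAnchorReduction`) specialised to the columnar class `IsColumnar`, which is
stable under dilations (`isColumnar_dilate`).  In the binder shape of the registered stub of line
`columnar_comparison_flow`: replacing the crux hypothesis `hw` by LATE columnar witnesses with a CORE-RADIUS FLOOR
(`hwl`) yields the stub's conclusion verbatim (singular anchor `xs`, anchored late level-`K` columnar witnesses for
every `K > 0`).  What remains research for the stub: lateness `(T-t)V ≤ KL` with a floor `r₀ ≤ KL`.

Consequently the line's composition runs for the LATE-FLOOR form of the crux with ONLY the shadowing stub open: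
`columnarCoreExclusion_lateFloor_of_shadowing` — the statement of the registered stub `stub_columnarShadowing` (taken
as a hypothesis, verbatim) together with the LANDED construction stub `ColumnarComparisonFlow.stub_columnarComparisonFlow`
(p829857) excludes every maximal smooth Leray–Hopf solution from a decaying datum carrying late columnar witnesses with a
core-radius floor (the Type-I exclusion `¬ IsTypeIBlowup` of the crux is not even needed).  Nothing about Navier–Stokes
regularity is claimed; the crux `ColumnarCoreExclusion` itself (hypothesis `hw`, no lateness) is NOT proved.
-/

noncomputable section

open Set Metric MeasureTheory Function Filter Topology
open Literature.Analysis Literature.Analysis.FluidPDE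
open scoped ENNReal

namespace Summit.NavierStokesRegularity.NavierStokesRegularity.Theorems

-- the problem directory repeats the summit name (`NavierStokesRegularity/NavierStokesRegularity`)
set_option linter.dupNamespace false

namespace CoreExclusionAnchor

/-- Columnar profiles are stable under dilations `W ↦ W(c·)` (`IsColumnar.rescale` at the origin). [folklore] -/
theorem isColumnar_dilate {W : EuclideanSpace ℝ (Fin 3) → EuclideanSpace ℝ (Fin 3)} (hW : IsColumnar W)
    (c : ℝ) : IsColumnar (fun y => W (c • y)) := by
  have h := hW.rescale 0 c
  simpa only [zero_add] using h

/-- **Crux `ColumnarCoreExclusion` (stmt-1966), anchor stub reduced.**  In the binder shape of the registered stub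
`stub_anchoredLateColumnarWitness` (line `columnar_comparison_flow`): if the columnar witnesses of the crux can be
taken LATE with a CORE-RADIUS FLOOR (`hwl`, in place of the crux's `hw`), the stub's conclusion holds verbatim —
a singular anchor `xs` and, at every level `K > 0`, a late level-`K` columnar witness anchored at `xs`.
[folklore] -/
theorem anchoredLateColumnarWitness_of_lateWitnesses_radiusFloor {ν T : ℝ}
    {u : ℝ → EuclideanSpace ℝ (Fin 3) → EuclideanSpace ℝ (Fin 3)}
    {p : ℝ → EuclideanSpace ℝ (Fin 3) → ℝ}
    (hν : 0 < ν) (hT : 0 < T) (hmax : IsMaximalSmoothSolution ν 0 u p T)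
    (hLH : IsLerayHopfOn T ν 0 (u 0) u) (hdec : HasRapidSpatialDecay (u 0))
    (hwl : ∃ r₀ : ℝ, 0 < r₀ ∧ ∀ K : ℝ, 0 < K → ∀ t₀ < T, ∃ t, t₀ < t ∧ t < T ∧
      ∃ (x₀ : EuclideanSpace ℝ (Fin 3)) (L V : ℝ)
        (Q : EuclideanSpace ℝ (Fin 3) ≃ₗᵢ[ℝ] EuclideanSpace ℝ (Fin 3))
        (W : EuclideanSpace ℝ (Fin 3) → EuclideanSpace ℝ (Fin 3)),
        0 < L ∧ 0 < V ∧ IsColumnar W ∧ (∀ x, ‖u t x‖ ≤ V) ∧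
        (∃ x₁, dist x₁ x₀ ≤ L ∧ V ≤ 2 * ‖u t x₁‖) ∧
        (∃ y y' : EuclideanSpace ℝ (Fin 3), ‖y‖ ≤ 1 ∧ ‖y'‖ ≤ 1 ∧ (4 : ℝ)⁻¹ ≤ ‖W y - W y'‖) ∧
        K * ν ≤ L * V ∧
        (∀ y : EuclideanSpace ℝ (Fin 3), ‖y‖ ≤ K →
          ‖V⁻¹ • Q.symm (u t (x₀ + L • Q y)) - W y‖ ≤ K⁻¹) ∧
        (T - t) * V ≤ K * L ∧ r₀ ≤ K * L) :
    ∃ xs : EuclideanSpace ℝ (Fin 3),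
      (¬ ∃ ρ M : ℝ, 0 < ρ ∧ ∀ s ∈ Ioo (T - ρ ^ 2) T, ∀ x ∈ ball xs ρ, ‖u s x‖ ≤ M) ∧
      ∀ K : ℝ, 0 < K → ∃ t : ℝ, 0 < t ∧ t < T ∧
        ∃ (x₀ : EuclideanSpace ℝ (Fin 3)) (L V : ℝ)
          (Q : EuclideanSpace ℝ (Fin 3) ≃ₗᵢ[ℝ] EuclideanSpace ℝ (Fin 3))
          (W : EuclideanSpace ℝ (Fin 3) → EuclideanSpace ℝ (Fin 3)),
          0 < L ∧ 0 < V ∧ IsColumnar W ∧ (∀ x, ‖u t x‖ ≤ V) ∧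
          (∃ x₁, dist x₁ x₀ ≤ L ∧ V ≤ 2 * ‖u t x₁‖) ∧
          (∃ y y' : EuclideanSpace ℝ (Fin 3), ‖y‖ ≤ 1 ∧ ‖y'‖ ≤ 1 ∧ (4 : ℝ)⁻¹ ≤ ‖W y - W y'‖) ∧
          K * ν ≤ L * V ∧
          (∀ y : EuclideanSpace ℝ (Fin 3), ‖y‖ ≤ K →
            ‖V⁻¹ • Q.symm (u t (x₀ + L • Q y)) - W y‖ ≤ K⁻¹) ∧
          (T - t) * V ≤ K * L ∧ dist xs x₀ ≤ K * L / 4 :=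
  anchoredLateWitness_of_lateWitnesses_radiusFloor (C := IsColumnar)
    (fun _ hW c _ => isColumnar_dilate hW c) hν hT hmax hLH hdec hwl

/-- **The late-floor form of crux `ColumnarCoreExclusion` follows from the shadowing stub alone.**  Assume the
statement of the registered stub `stub_columnarShadowing` (finite-horizon local shadowing of a bounded columnar
classical flow by the solution, hypothesis `hShadow`, verbatim).  Then no maximal smooth solution on `[0,T)`,
Leray–Hopf from a rapidly decaying datum, carries LATE columnar core witnesses with a core-radius floor at every level
frequently before `T`: the anchor reduction gives a singular point `xs` and an anchored late level-`K₀` witness, the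
landed construction stub `ColumnarComparisonFlow.stub_columnarComparisonFlow` a bounded columnar comparison flow
`A·V/K₀`-close on `B(x₀, K₀L/2)`, the shadowing hypothesis a bound on `[t,T) × B(x₀, 3K₀L/8)`, which contains the
parabolic neighbourhood `(T-ρ²,T) × B_ρ(xs)`, `ρ = min (K₀L/8) √(T-t)` — contradiction. [folklore] -/
theorem columnarCoreExclusion_lateFloor_of_shadowing
    (hShadow : ∀ A : ℝ, 0 < A → ∃ K₀ : ℝ, 1 ≤ K₀ ∧ ∀ K : ℝ, K₀ ≤ K →
      ∀ (ν T t : ℝ) (u : ℝ → EuclideanSpace ℝ (Fin 3) → EuclideanSpace ℝ (Fin 3))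
        (p : ℝ → EuclideanSpace ℝ (Fin 3) → ℝ),
        0 < ν → 0 < T → IsClassicalNSSolutionOn (Ico 0 T) ν 0 u p → IsLerayHopfOn T ν 0 (u 0) u →
        HasRapidSpatialDecay (u 0) → 0 < t → t < T →
        ∀ (x₀ : EuclideanSpace ℝ (Fin 3)) (L V : ℝ)
          (Q : EuclideanSpace ℝ (Fin 3) ≃ₗᵢ[ℝ] EuclideanSpace ℝ (Fin 3)),
          0 < L → 0 < V → (∀ x, ‖u t x‖ ≤ V) →
          (∃ x₁, dist x₁ x₀ ≤ L ∧ V ≤ 2 * ‖u t x₁‖) → K * ν ≤ L * V → (T - t) * V ≤ K * L →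
          ∀ (v : ℝ → EuclideanSpace ℝ (Fin 3) → EuclideanSpace ℝ (Fin 3))
            (q : ℝ → EuclideanSpace ℝ (Fin 3) → ℝ) (Mv : ℝ),
            IsClassicalNSSolutionOn (Icc t T) ν 0 v q →
            (∀ s ∈ Icc t T, ∀ (x : EuclideanSpace ℝ (Fin 3)) (τ : ℝ), v s (x + τ • Q eZ) = v s x) →
            (∀ s ∈ Icc t T, ∀ x, ‖v s x‖ ≤ Mv) →
            (∀ x ∈ ball x₀ (K * L / 2), ‖u t x - v t x‖ ≤ A * V / K) →
            ∃ M : ℝ, ∀ s ∈ Ico t T, ∀ x ∈ ball x₀ (3 * K * L / 8), ‖u s x‖ ≤ M)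
    {ν T : ℝ} {u : ℝ → EuclideanSpace ℝ (Fin 3) → EuclideanSpace ℝ (Fin 3)}
    {p : ℝ → EuclideanSpace ℝ (Fin 3) → ℝ}
    (hν : 0 < ν) (hT : 0 < T) (hmax : IsMaximalSmoothSolution ν 0 u p T)
    (hLH : IsLerayHopfOn T ν 0 (u 0) u) (hdec : HasRapidSpatialDecay (u 0))
    (hwl : ∃ r₀ : ℝ, 0 < r₀ ∧ ∀ K : ℝ, 0 < K → ∀ t₀ < T, ∃ t, t₀ < t ∧ t < T ∧
      ∃ (x₀ : EuclideanSpace ℝ (Fin 3)) (L V : ℝ)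
        (Q : EuclideanSpace ℝ (Fin 3) ≃ₗᵢ[ℝ] EuclideanSpace ℝ (Fin 3))
        (W : EuclideanSpace ℝ (Fin 3) → EuclideanSpace ℝ (Fin 3)),
        0 < L ∧ 0 < V ∧ IsColumnar W ∧ (∀ x, ‖u t x‖ ≤ V) ∧
        (∃ x₁, dist x₁ x₀ ≤ L ∧ V ≤ 2 * ‖u t x₁‖) ∧
        (∃ y y' : EuclideanSpace ℝ (Fin 3), ‖y‖ ≤ 1 ∧ ‖y'‖ ≤ 1 ∧ (4 : ℝ)⁻¹ ≤ ‖W y - W y'‖) ∧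
        K * ν ≤ L * V ∧
        (∀ y : EuclideanSpace ℝ (Fin 3), ‖y‖ ≤ K →
          ‖V⁻¹ • Q.symm (u t (x₀ + L • Q y)) - W y‖ ≤ K⁻¹) ∧
        (T - t) * V ≤ K * L ∧ r₀ ≤ K * L) :
    False := by
  obtain ⟨A, hA, hcomp⟩ := ColumnarComparisonFlow.stub_columnarComparisonFlow
  obtain ⟨K₀, hK₀1, hstab⟩ := hShadow A hA
  have hK₀ : 0 < K₀ := lt_of_lt_of_le one_pos hK₀1
  obtain ⟨xs, hsing, hcov⟩ :=
    anchoredLateColumnarWitness_of_lateWitnesses_radiusFloor hν hT hmax hLH hdec hwl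
  obtain ⟨t, ht0, htT, x₀, L, V, Q, W, hL, hV, hcol, hbd, hnear, hosc, hRe, hclose, hlate, hdist⟩ :=
    hcov K₀ hK₀
  obtain ⟨v, q, Mv, hv, hvcol, hvbd, hvclose⟩ :=
    hcomp ν T t K₀ u p hν hT hmax.1 hLH hdec ht0 htT hK₀1 x₀ L V Q W hL hV hcol hbd hRe hclose
  obtain ⟨M, hM⟩ := hstab K₀ le_rfl ν T t u p hν hT hmax.1 hLH hdec ht0 htT x₀ L V Q hL hV hbd hnear
    hRe hlate v q Mv hv hvcol hvbd hvclose
  apply hsing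
  have hTt : 0 < T - t := sub_pos.2 htT
  set ρ : ℝ := min (K₀ * L / 8) (Real.sqrt (T - t)) with hρ
  have hρpos : 0 < ρ := lt_min (by positivity) (Real.sqrt_pos.2 hTt)
  have hρsq : ρ ^ 2 ≤ T - t :=
    calc ρ ^ 2 ≤ (Real.sqrt (T - t)) ^ 2 := pow_le_pow_left₀ hρpos.le (min_le_right _ _) 2
      _ = T - t := Real.sq_sqrt hTt.le
  have hρle : ρ ≤ K₀ * L / 8 := min_le_left _ _
  refine ⟨ρ, M, hρpos, fun s hs x hx => hM s ⟨?_, hs.2⟩ x ?_⟩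
  · linarith [hs.1]
  · rw [mem_ball] at hx ⊢
    calc dist x x₀ ≤ dist x xs + dist xs x₀ := dist_triangle _ _ _
      _ < ρ + K₀ * L / 4 := by linarith
      _ ≤ K₀ * L / 8 + K₀ * L / 4 := by linarith
      _ = 3 * K₀ * L / 8 := by ring

end CoreExclusionAnchor

end Summit.NavierStokesRegularity.NavierStokesRegularity.Theorems

end
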